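import Mathlib.NumberTheory.LSeries.Basic
import Mathlib.NumberTheory.LSeries.Convergence
import Mathlib.NumberTheory.ModularForms.Bounds
import Mathlib.NumberTheory.DirichletCharacter.Basic
import Mathlib.Analysis.MellinTransform
import Mathlib.Analysis.SpecialFunctions.Gamma.Basic
import Mathlib.AlgebraicGeometry.EllipticCurve.LFunction
import Literature.NumberTheory.EllipticCurves.HeckeOperators
import Literature.NumberTheory.EllipticCurves.Newforms
import Literature.NumberTheory.DiophantineGeometry.Conductor
import Literature.NumberTheory.EllipticCurves.AnalyticRank
import HarnessLib

-- D-0014 sorry-sweep (operator, 2026-08-13): sorried theorems -> named facts `def X : Prop`; partial proofs preserved in comments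
-- provenance: harness21/H21/H21/Prelude/EllArithM/CuspFormLFunction.lean @ 50fe52b (interim HEAD d8f2665); M5 mechanical rewrite
/-!
# L-functions of cusp forms, the Fricke involution, modularity (trunk EllArithM, item C7)

For a cusp form `f = ∑_{n ≥ 1} aₙ qⁿ` (`q = e^{2πiτ}`) on an arithmetic subgroup whose cusp at
`∞` has width `1` (e.g. `Γ₀(N)`, `Γ₁(N)`), we define

* `cuspCoeff f n = aₙ`, the `n`-th coefficient of the period-`1` `q`-expansion
  (Mathlib `UpperHalfPlane.qExpansion 1 ⇑f`);
* `cuspFormLSeries f s = L(f, s) = ∑ aₙ n⁻ˢ` (Mathlib `LSeries`), absolutely convergent for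
  `re s > k/2 + 1` by Hecke's bound `aₙ = O(n^{k/2})` (Mathlib `CuspFormClass.qExpansion_isBigO`;
  our `LSeriesSummable_cuspCoeff` is proved from it);
* `completedCuspFormL N f s = Λ_N(f, s) = N^{s/2} (2π)^{-s} Γ(s) L(f, s)`, the *raw* product
  (Diamond–Shurman §5.10). Since `Complex.Gamma` has junk value `0` at the poles and `LSeries` is
  junk off its half-plane of convergence, no identity about this raw product is ever asserted
  outside `re s > k/2 + 1`; instead `completedCuspFormLContinuations N f` is the (subsingleton) set
  of entire functions agreeing with it there, and the functional equation quantifies over it;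
* `twistedLSeries f χ s = L(f ⊗ χ, s) = ∑ χ(n) aₙ n⁻ˢ`;
* `frickeGL N = w_N = (0 -1; N 0) ∈ GL(2, ℚ)⁺` and the **Fricke involution**
  `frickeInvolution N k : S_k(Γ₀(N)) →ₗ[ℂ] S_k(Γ₀(N))`,
  `(w_N f)(τ) = N^{-k/2} τ^{-k} f(-1/(Nτ))`, i.e. `N^{1-k/2} • (f ∣[k] w_N)` with Mathlib's slash
  action (which carries `det^{k-1}`); this is the `det^{k/2}`-normalised action of Atkin–Lehner
  1970, for which `w_N² = (-1)^k` and the functional equation reads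
  `Λ_N(f, s) = i^k Λ_N(w_N f, k - s)` (Diamond–Shurman Thm. 5.10.2, whose `W_N` is `i^k` times
  ours); `frickeEigenvalue f` (called `frickeSign` in an earlier draft of the outline; renamed
  since for general eigenforms it is an eigenvalue, a sign only for newforms on `Γ₀(N)`);
* modularity glue for a Weierstrass curve `W / ℚ`: `IsNewformOf W f` says that
  `f ∈ S_2(Γ₀(N))` is a newform with `aₙ(f) = aₙ(W)` for all `n` (Mathlib
  `WeierstrassCurve.LFunction : ArithmeticFunction ℤ`), and `existsUnique_isNewformOf` is the
  modularity theorem at level `N = N_W` (`WeierstrassCurve.conductorNorm ℤ`, item G22). It splits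
  (`existsUnique_isNewformOf_iff`) into the named fact `exists_isNewformOf` (Modularity Theorem,
  "Version `L`", Diamond–Shurman Thm. 8.8.3) and the proved uniqueness `IsNewformOf.unique`
  (`q`-expansion principle `eq_of_forall_cuspCoeff_eq`, from Mathlib `hasSum_qExpansion`).

## Design notes

* Everything is in `namespace Literature.ModularForms` (OUTLINE, review 9b).
* Mathlib has no `L`-function of a modular form, no Fricke/Atkin–Lehner operator and no newforms
  (searched `Fricke`, `atkinLehner`, `LSeries.*qExpansion`, `newform`); it does have `LSeries`,
  `mellin`, `Complex.Gamma`, `qExpansion` and Hecke's bound `CuspFormClass.qExpansion_isBigO`,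
  all of which are used here rather than redefined.
* `frickeGL N` is in `GL(2, ℚ)⁺` (not merely `GL(2, ℚ)`), as required by the `ℂ`-linear Hecke
  operator `cuspHeckeOperatorₗ` of item C5.
* The `NeZero (W.conductorNorm ℤ)` instance in `existsUnique_isNewformOf` is an explicit instance
  argument; it is *not* manufactured from the (sorried) theorem
  `WeierstrassCurve.conductorNorm_pos`.
* Root numbers (item C3/G06 `RootNumber`) are not imported: for `IsNewformOf W f` one has
  `frickeEigenvalue f = - rootNumber W` (weight `2`: `Λ(f, s) = i² Λ(w_N f, 2 - s)
  = -ε Λ(f, 2 - s)`); this is recorded here only as a remark.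

## References

* E. Hecke, *Über die Bestimmung Dirichletscher Reihen durch ihre Funktionalgleichung*,
  Math. Ann. 112 (1936), 664–699.
* A. O. L. Atkin, J. Lehner, *Hecke operators on `Γ₀(m)`*, Math. Ann. 185 (1970), Thm. 3, Lemma 7.
* F. Diamond, J. Shurman, *A first course in modular forms*, GTM 228, 2005, §5.9–5.10, Thm. 5.9.2,
  Prop. 5.9.1, Thm. 5.10.2.
* F. Diamond, J. Shurman, op. cit., §8.8, Thm. 8.8.1 (Modularity, Version `a_p`), Thm. 8.8.3
  (Version `L`), (8.43)–(8.44).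
* A. Wiles, *Modular elliptic curves and Fermat's Last Theorem*, Ann. of Math. 141 (1995),
  443–551; R. Taylor, A. Wiles, *Ring-theoretic properties of certain Hecke algebras*, ibid.
  553–572; C. Breuil, B. Conrad, F. Diamond, R. Taylor, *On the modularity of elliptic curves
  over `ℚ`: wild 3-adic exercises*, J. Amer. Math. Soc. 14 (2001), 843–939, Thm. A and §1 (2);
  H. Carayol, *Sur les représentations `ℓ`-adiques associées aux formes modulaires de Hilbert*,
  Ann. Sci. ÉNS 19 (1986) (level = conductor).
-/

noncomputable section

open scoped MatrixGroups ModularForm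

open CongruenceSubgroup UpperHalfPlane Complex Filter Topology

namespace Literature.NumberTheory.EllipticCurves.ModularForms

/-! ### Coefficients and the `L`-series -/

section LSeries

variable {Γ : Subgroup (GL (Fin 2) ℝ)} {k : ℤ}

/-- The `n`-th Fourier coefficient `aₙ(f)` of a cusp form, `f(τ) = ∑ aₙ e^{2πinτ}`: the `n`-th
coefficient of Mathlib's period-`1` `q`-expansion `qExpansion 1 ⇑f`. Meaningful for levels whose
cusp `∞` has strict width `1` (`Γ.strictWidthInfty = 1`, e.g. `Γ₀(N)`, `Γ₁(N)`, cf. Mathlib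
`CongruenceSubgroup.strictWidthInfty_Gamma0`) (Diamond–Shurman §1.1, §5.9). [folklore] -/
def cuspCoeff (f : CuspForm Γ k) (n : ℕ) : ℂ :=
  (qExpansion 1 ⇑f).coeff n

/-- A cusp form is normalised (item C6, `IsNormalized`) iff `a₁(f) = 1`
(Diamond–Shurman Def. 5.8.1). [folklore] -/
theorem isNormalized_iff_cuspCoeff_one (f : CuspForm Γ k) : IsNormalized f ↔ cuspCoeff f 1 = 1 :=
  Iff.rfl

/-- The **`L`-series of a cusp form**, `L(f, s) = ∑_{n ≥ 1} aₙ(f) n⁻ˢ` (Mathlib `LSeries` of the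
coefficient sequence; the `n = 0` term is dropped by `LSeries.term`). Converges absolutely for
`re s > k/2 + 1` (`LSeriesSummable_cuspCoeff`); elsewhere it is the junk value of a non-summable
`tsum` (Hecke 1936; Diamond–Shurman §5.9). [cite: Hecke1936] -/
def cuspFormLSeries (f : CuspForm Γ k) (s : ℂ) : ℂ :=
  LSeries (cuspCoeff f) s

/-- The **completed `L`-function** `Λ_N(f, s) = N^{s/2} (2π)^{-s} Γ(s) L(f, s)` at level `N`, as
the *raw* product (Diamond–Shurman §5.10, display before Thm. 5.10.2). Warning: `Complex.Gamma`
is `0` (junk) at `s ∈ ℤ_{≤ 0}` and `cuspFormLSeries` is junk off `re s > k/2 + 1`, so this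
expression is only meaningful on that half-plane; see `completedCuspFormLContinuations`. [folklore] -/
def completedCuspFormL (N : ℕ) (f : CuspForm Γ k) (s : ℂ) : ℂ :=
  (N : ℂ) ^ (s / 2) * (2 * Real.pi : ℂ) ^ (-s) * Complex.Gamma s * cuspFormLSeries f s

/-- The set of **entire continuations of `Λ_N(f, s)`**: entire functions `Λ : ℂ → ℂ` agreeing with
the raw product `completedCuspFormL N f` on the half-plane `re s > k/2 + 1` of absolute
convergence. It has at most one element (`subsingleton_completedCuspFormLContinuations`) and, for
`f ∈ S_k(Γ₀(N))`, exactly one (`exists_completedCuspFormL_functional_equation`)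
(Hecke 1936; Diamond–Shurman Thm. 5.10.2). [cite: Hecke1936] -/
def completedCuspFormLContinuations (N : ℕ) (f : CuspForm Γ k) : Set (ℂ → ℂ) :=
  {Λ | Differentiable ℂ Λ ∧ ∀ s : ℂ, (k : ℝ) / 2 + 1 < s.re → Λ s = completedCuspFormL N f s}

/-- Uniqueness of the entire continuation of `Λ_N(f, s)` (identity theorem on the connected
space `ℂ`; Diamond–Shurman Thm. 5.10.2). [folklore] -/
theorem subsingleton_completedCuspFormLContinuations (N : ℕ) (f : CuspForm Γ k) :
    (completedCuspFormLContinuations N f).Subsingleton := by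
  intro Λ₁ h₁ Λ₂ h₂
  refine AnalyticOnNhd.eq_of_eventuallyEq (z₀ := (((k : ℝ) / 2 + 2 : ℝ) : ℂ))
    (h₁.1.differentiableOn.analyticOnNhd isOpen_univ)
    (h₂.1.differentiableOn.analyticOnNhd isOpen_univ) ?_
  have hopen : IsOpen {s : ℂ | (k : ℝ) / 2 + 1 < s.re} :=
    isOpen_lt continuous_const Complex.continuous_re
  have hmem : (k : ℝ) / 2 + 1 < (((k : ℝ) / 2 + 2 : ℝ) : ℂ).re := by
    rw [Complex.ofReal_re]; linarith
  filter_upwards [hopen.mem_nhds hmem] with s hs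
  rw [h₁.2 s hs, h₂.2 s hs]

/-- The **twisted `L`-series** `L(f ⊗ χ, s) = ∑_{n ≥ 1} χ(n) aₙ(f) n⁻ˢ` of a cusp form by a
Dirichlet character `χ` mod `m` (Diamond–Shurman §5.10, Ex. 5.10.5; Shimura 1971, Thm. 3.66). [cite: Shimura1971, Thm. 3.66] -/
def twistedLSeries (f : CuspForm Γ k) {m : ℕ} (χ : DirichletCharacter ℂ m) (s : ℂ) : ℂ :=
  LSeries (fun n ↦ χ n * cuspCoeff f n) s

/-- **Hecke's bound gives absolute convergence**: for a cusp form of weight `k` on an arithmetic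
subgroup with cusp width `1` at `∞`, `L(f, s) = ∑ aₙ n⁻ˢ` converges absolutely for
`re s > k/2 + 1`, since `aₙ = O(n^{k/2})` (Diamond–Shurman Prop. 5.9.1; Mathlib
`CuspFormClass.qExpansion_isBigO`). [folklore] -/
theorem LSeriesSummable_cuspCoeff [Γ.IsArithmetic] (hΓ : Γ.strictWidthInfty = 1)
    (f : CuspForm Γ k) {s : ℂ} (hs : (k : ℝ) / 2 + 1 < s.re) :
    LSeriesSummable (cuspCoeff f) s := by
  refine LSeriesSummable_of_isBigO_rpow hs ?_
  have h := CuspFormClass.qExpansion_isBigO f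
  rw [hΓ, show (fun n ↦ (qExpansion 1 ⇑f).coeff n) = cuspCoeff f from rfl] at h
  simpa only [add_sub_cancel_right] using h

/-- On `Γ₀(N)` (cusp width `1`): `L(f, s)` converges absolutely for `re s > k/2 + 1`
(Diamond–Shurman Prop. 5.9.1). [folklore] -/
theorem LSeriesSummable_cuspCoeff_gamma0 {N : ℕ} [NeZero N] (f : CuspForm (Gamma0 N) k) {s : ℂ}
    (hs : (k : ℝ) / 2 + 1 < s.re) : LSeriesSummable (cuspCoeff f) s :=
  LSeriesSummable_cuspCoeff (strictWidthInfty_Gamma0 N) f hs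

/-- **Mellin transform formula**: for `re s > k/2 + 1`,
`∫₀^∞ f(it) t^s dt/t = (2π)^{-s} Γ(s) L(f, s)`, i.e.
`L(f, s) = (2π)^s / Γ(s) · 𝓜(t ↦ f(it))(s)` (Mathlib `mellin`; `Γ(s) ≠ 0` there)
(Hecke 1936; Diamond–Shurman §5.10, (5.35)). [cite: Hecke1936] -/
def cuspFormLSeries_eq_mellin : Prop :=
  ∀ [Γ.IsArithmetic] (hΓ : Γ.strictWidthInfty = 1) (f : CuspForm Γ k) {s : ℂ} (hs : (k : ℝ) / 2 + 1 < s.re),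
    cuspFormLSeries f s =
      (2 * Real.pi : ℂ) ^ s / Complex.Gamma s *
        mellin (fun t : ℝ ↦ f (ofComplex (Complex.I * t))) s

/-- `L(f, s)` extends to an entire function (Hecke 1936; Diamond–Shurman Thm. 5.10.2), for `f` a
cusp form on `Γ₀(N)`. [cite: Hecke1936] -/
def exists_differentiable_eq_cuspFormLSeries : Prop :=
  ∀ {N : ℕ} [NeZero N] (f : CuspForm (Gamma0 N) k),
    ∃ L : ℂ → ℂ, Differentiable ℂ L ∧ ∀ s : ℂ, (k : ℝ) / 2 + 1 < s.re → L s = cuspFormLSeries f s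

end LSeries

/-! ### The Fricke involution -/

section Fricke

variable (N : ℕ) [NeZero N] (k : ℤ)

/-- The **Fricke matrix** `w_N = (0 -1; N 0) ∈ GL(2, ℚ)⁺` (determinant `N > 0`); it normalises
`Γ₀(N)` and `Γ₁(N)` (Atkin–Lehner 1970, §2; Diamond–Shurman §5.10, `ω_N`). [cite: AtkinLehner1970, §2] -/
def frickeGL : GL(2, ℚ)⁺ :=
  ⟨Matrix.GeneralLinearGroup.mkOfDetNeZero !![(0 : ℚ), -1; N, 0]
      (by simp [Matrix.det_fin_two, NeZero.ne N]),
    by simp [Matrix.det_fin_two, NeZero.pos N]⟩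

/-- The underlying matrix of `frickeGL N` is `(0 -1; N 0)` (cf. Atkin–Lehner 1970, §2). [cite: AtkinLehner1970, §2] -/
@[simp] lemma coe_coe_frickeGL :
    ((frickeGL N : GL (Fin 2) ℚ) : Matrix (Fin 2) (Fin 2) ℚ) = !![(0 : ℚ), -1; N, 0] :=
  rfl

/-- The **Fricke involution** `w_N` on `S_k(Γ₀(N))`:
`(w_N f)(τ) = N^{-k/2} τ^{-k} f(-1/(Nτ))`, realised as `N^{1-k/2} • [Γ₀(N) w_N Γ₀(N)]`. Since
`w_N` normalises `Γ₀(N)`, the double coset `Γ₀(N) w_N Γ₀(N) = Γ₀(N) w_N` is a single coset, the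
trace in `cuspHeckeOperatorₗ` is over a one-element quotient, and this is
`f ↦ N^{1-k/2} • (f ∣[k] w_N)` (`frickeInvolution_apply_eq_slash`); the scalar converts Mathlib's
`det^{k-1}`-normalised slash action into the classical `det^{k/2}`-normalised one, for which
`w_N ∘ w_N = (-1)^k` and newforms have eigenvalue `±1` (Atkin–Lehner 1970, §2 and Lemma 7;
Diamond–Shurman §5.10, whose operator `W_N` equals `i^k` times this one). [cite: AtkinLehner1970, §2 and Lemma 7] -/
def frickeInvolution : CuspForm (Gamma0 N) k →ₗ[ℂ] CuspForm (Gamma0 N) k :=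
  (((N : ℝ) ^ (1 - (k : ℝ) / 2) : ℝ) : ℂ) • cuspHeckeOperatorₗ (Gamma0 N) k (frickeGL N)

/-- `w_N f = N^{1-k/2} • (f ∣[k] w_N)` as functions on `ℍ` (the trace defining the Hecke operator
`[Γ₀(N) w_N Γ₀(N)]` has a single term because `w_N` normalises `Γ₀(N)`; Atkin–Lehner 1970, §2;
Diamond–Shurman §5.10). [cite: AtkinLehner1970, §2] -/
def frickeInvolution_apply_eq_slash : Prop :=
  ∀ (f : CuspForm (Gamma0 N) k),
    (⇑(frickeInvolution N k f) : ℍ → ℂ) =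
      (((N : ℝ) ^ (1 - (k : ℝ) / 2) : ℝ) : ℂ) • (⇑f ∣[k] glCast (frickeGL N : GL (Fin 2) ℚ))

/-- `w_N` is an involution up to sign: `w_N (w_N f) = (-1)^k f` (`w_N² = -N` is scalar)
(Atkin–Lehner 1970, Lemma 7; Diamond–Shurman §5.10). [cite: AtkinLehner1970, Lemma 7] -/
def frickeInvolution_frickeInvolution : Prop :=
  ∀ (f : CuspForm (Gamma0 N) k),
    frickeInvolution N k (frickeInvolution N k f) = ((-1 : ℂ) ^ k) • f

variable {N k}

open scoped Classical in
/-- The **Fricke eigenvalue** `ε(f)` of `f ∈ S_k(Γ₀(N))` (the outline's `frickeSign`): the scalar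
`ε` with `w_N f = ε • f` if `f` is a `w_N`-eigenvector (unspecified if `f = 0`), junk value `0`
otherwise. For a newform, `ε = ±1` (`IsNewform0.frickeEigenvalue_eq_one_or_eq_neg_one`); for `f`
attached to an elliptic curve `E / ℚ` (`IsNewformOf`), `ε = -w(E)` is minus the global root
number (Atkin–Lehner 1970, Thm. 3; Diamond–Shurman §5.10). [cite: AtkinLehner1970, Thm. 3] -/
def frickeEigenvalue (f : CuspForm (Gamma0 N) k) : ℂ :=
  if h : ∃ ε : ℂ, frickeInvolution N k f = ε • f then h.choose else 0

/-- Defining property of `frickeEigenvalue`: if `f` is a `w_N`-eigenvector then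
`w_N f = ε(f) • f` (cf. Atkin–Lehner 1970, §2). [cite: AtkinLehner1970, §2] -/
theorem frickeInvolution_eq_frickeEigenvalue_smul {f : CuspForm (Gamma0 N) k}
    (h : ∃ ε : ℂ, frickeInvolution N k f = ε • f) :
    frickeInvolution N k f = frickeEigenvalue f • f := by
  rw [frickeEigenvalue, dif_pos h]
  exact h.choose_spec

end Fricke

/-! ### Functional equation, Euler product, Fricke eigenvalues of newforms -/

section FunctionalEquation

variable {N : ℕ} [NeZero N] {k : ℤ}

variable (N k) in
/-- **Hecke's functional equation** (Hecke 1936; Diamond–Shurman Thm. 5.10.2): for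
`f ∈ S_k(Γ₀(N))`, both `Λ_N(f, s)` and `Λ_N(w_N f, s)` extend to entire functions `Λ`, `Λ'`, and
`Λ(s) = i^k Λ'(k - s)` for all `s`. (Diamond–Shurman state it for `W_N`-eigenforms,
`W_N f = ± f ⇒ Λ_N(s) = ± Λ_N(k - s)`, with `W_N = i^k w_N`; this is the equivalent general form.)
Both sides are the entire continuations, never the raw products. [cite: Hecke1936] -/
def exists_completedCuspFormL_functional_equation : Prop :=
  ∀ (f : CuspForm (Gamma0 N) k),
    ∃ Λ ∈ completedCuspFormLContinuations N f,
      ∃ Λ' ∈ completedCuspFormLContinuations N (frickeInvolution N k f),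
        ∀ s : ℂ, Λ s = Complex.I ^ k * Λ' (k - s)

/-- A newform on `Γ₀(N)` is an eigenvector of the Fricke involution with eigenvalue `±1`
(Atkin–Lehner 1970, Thm. 3: `f ∣ W_N = λ_N f`, `λ_N = ∏_{q ‖ N} λ_q = ±1`; Diamond–Shurman
§5.10). (For newforms on `Γ₁(N)` with non-trivial nebentypus `w_N f` is instead a unimodular
multiple of the newform with complex-conjugate coefficients; not stated here.) [cite: AtkinLehner1970, Thm. 3:  f ∣ W_N = λ_N f    λ_N = ∏_{q ‖] -/
def IsNewform0.exists_frickeInvolution_eq_smul : Prop :=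
  ∀ {f : CuspForm (Gamma0 N) k} (hf : IsNewform0 f),
    ∃ ε : ℂ, (ε = 1 ∨ ε = -1) ∧ frickeInvolution N k f = ε • f

/-- For a newform, `frickeEigenvalue f = ±1` (Atkin–Lehner 1970, Thm. 3). [cite: AtkinLehner1970, Thm. 3] -/
def IsNewform0.frickeEigenvalue_eq_one_or_eq_neg_one : Prop :=
  ∀ {f : CuspForm (Gamma0 N) k} (hf : IsNewform0 f),
    frickeEigenvalue f = 1 ∨ frickeEigenvalue f = -1

/-- For a newform, `w_N f = ε(f) • f` with `ε(f) = frickeEigenvalue f`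
(Atkin–Lehner 1970, Thm. 3). [cite: AtkinLehner1970, Thm. 3] -/
def IsNewform0.frickeInvolution_eq_smul : Prop :=
  ∀ {f : CuspForm (Gamma0 N) k} (hf : IsNewform0 f),
    frickeInvolution N k f = frickeEigenvalue f • f

/- interim proof relied on results that are now named facts (D-0014); demoted to a fact by the D-0014 sorry-sweep, proof preserved:
:= by
  obtain ⟨ε, -, hε⟩ := hf.exists_frickeInvolution_eq_smul
  exact frickeInvolution_eq_frickeEigenvalue_smul ⟨ε, hε⟩
-/

/-- Functional equation for a newform: `Λ_N(f, s) = i^k ε(f) Λ_N(f, k - s)` for the entire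
continuation `Λ` of `Λ_N(f, s)`, `ε(f) = frickeEigenvalue f = ±1` (Hecke 1936; Atkin–Lehner
1970, Thm. 3; Diamond–Shurman Thm. 5.10.2). [cite: Hecke1936] -/
def IsNewform0.exists_functional_equation : Prop :=
  ∀ {f : CuspForm (Gamma0 N) k} (hf : IsNewform0 f),
    ∃ Λ ∈ completedCuspFormLContinuations N f,
      ∀ s : ℂ, Λ s = Complex.I ^ k * frickeEigenvalue f * Λ (k - s)

/-- **Euler product of a newform** (Diamond–Shurman Thm. 5.9.2; Atkin–Lehner 1970, Thm. 3): for
`re s > k/2 + 1`,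
`L(f, s) = ∏_p (1 - a_p p⁻ˢ + 𝟙_N(p) p^{k-1-2s})⁻¹`, where `𝟙_N(p) = 0` for `p ∣ N` and `1`
otherwise; the product over primes converges (as `HasProd` over `Nat.Primes`). [cite: AtkinLehner1970, Thm. 3] -/
def IsNewform0.hasProd_cuspFormLSeries : Prop :=
  ∀ {f : CuspForm (Gamma0 N) k} (hf : IsNewform0 f) {s : ℂ} (hs : (k : ℝ) / 2 + 1 < s.re),
    HasProd (fun p : Nat.Primes ↦
      (1 - cuspCoeff f p * (p : ℂ) ^ (-s) +
        (if (p : ℕ) ∣ N then 0 else (p : ℂ) ^ ((k : ℂ) - 1 - 2 * s)))⁻¹)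
      (cuspFormLSeries f s)

end FunctionalEquation

/-! ### Modularity: newforms attached to Weierstrass curves over `ℚ` -/

section Modularity

variable {N : ℕ} [NeZero N]

/-- `IsNewformOf W f`: the weight-`2` cusp form `f ∈ S_2(Γ₀(N))` is *the newform attached to the
Weierstrass curve `W / ℚ`*, i.e. `f` is a (normalised, new, Hecke eigen-) newform and its Fourier
coefficients are the Dirichlet coefficients of `L(W, s)`: `aₙ(f) = aₙ(W)` for all `n` (Mathlib
`WeierstrassCurve.LFunction : ArithmeticFunction ℤ`; in particular `L(f, s) = L(W, s)`)
(Breuil–Conrad–Diamond–Taylor 2001, Thm. A; Diamond–Shurman Thm. 8.8.1 / Def. 8.8.2). [cite: BreuilConradDiamondTaylor2001, Thm. A] -/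
def IsNewformOf (W : WeierstrassCurve ℚ) (f : CuspForm (Gamma0 N) 2) : Prop :=
  IsNewform0 f ∧ ∀ n : ℕ, cuspCoeff f n = (W.LFunction n : ℂ)

/-- If `f` is the newform of `W` then `L(f, s) = L(W, s)` as `L`-series (all `s`; both sides are
the same `LSeries`). [folklore] -/
theorem IsNewformOf.cuspFormLSeries_eq {W : WeierstrassCurve ℚ} {f : CuspForm (Gamma0 N) 2}
    (h : IsNewformOf W f) (s : ℂ) : cuspFormLSeries f s = W.LSeries s := by
  unfold cuspFormLSeries WeierstrassCurve.LSeries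
  congr 1
  funext n
  exact h.2 n

/-- **Modularity theorem** (Wiles 1995; Taylor–Wiles 1995; Breuil–Conrad–Diamond–Taylor 2001,
Thm. A) **with level = conductor** (Carayol 1986; Diamond–Shurman Thm. 8.8.1, "Version `a_p`"
8.8.2): for every elliptic curve `E / ℚ` of conductor `N_E` there is a unique newform
`f ∈ S_2(Γ₀(N_E))` with `aₙ(f) = aₙ(E)` for all `n`. The instance `NeZero (W.conductorNorm ℤ)`
holds for elliptic `W` (`WeierstrassCurve.conductorNorm_pos`, item G22) and is taken as an
argument. [cite: Wiles1995] -/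
def existsUnique_isNewformOf : Prop :=
  ∀ (W : WeierstrassCurve ℚ) [W.IsElliptic] [NeZero (W.conductorNorm ℤ)],
    ∃! f : CuspForm (Gamma0 (W.conductorNorm ℤ)) 2, IsNewformOf W f

/-- The level of the newform attached to `W` is its conductor (Carayol 1986; Diamond–Shurman
Thm. 8.8.1): if `IsNewformOf W f` with `f ∈ S_2(Γ₀(N))` then `N = N_W`. [cite: Carayol1986] -/
def IsNewformOf.level_eq_conductorNorm : Prop :=
  ∀ {W : WeierstrassCurve ℚ} [W.IsElliptic] {f : CuspForm (Gamma0 N) 2} (h : IsNewformOf W f),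
    N = W.conductorNorm ℤ

/-- If `f` is the newform of `W`, the entire `L`-function of `W` (item G06,
`WeierstrassCurve.entireLFunction`) agrees with `L(f, s)` on `re s > 3/2` (and hence its unique
entire continuation is that of `L(f, s)`) (Breuil–Conrad–Diamond–Taylor 2001; Silverman AEC C.16). [cite: BreuilConradDiamondTaylor2001] -/
def IsNewformOf.entireLFunction_eq : Prop :=
  ∀ {W : WeierstrassCurve ℚ} [W.IsElliptic] {f : CuspForm (Gamma0 N) 2} (h : IsNewformOf W f) {s : ℂ} (hs : (3 / 2 : ℝ) < s.re),
    W.entireLFunction s = cuspFormLSeries f s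

/- interim proof relied on results that are now named facts (D-0014); demoted to a fact by the D-0014 sorry-sweep, proof preserved:
:= by
  rw [h.cuspFormLSeries_eq]
  exact W.entireLFunction_eq_LSeries (WeierstrassCurve.hasEntireLFunction_rat W) hs
-/

/-- If `f` is the newform of `W`, then on the half-plane `re s > 2` (weight `k = 2`, so
`k/2 + 1 = 2`) the raw products agree: `Λ_N(f, s) = Λ(W, s)`, where
`Λ(W, s) = N^{s/2} (2π)^{-s} Γ(s) L(W, s)` is item G06's `WeierstrassCurve.completedLFunction`
(built on `W.entireLFunction`, which equals `L(f, s)` there by `entireLFunction_eq`)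
(Breuil–Conrad–Diamond–Taylor 2001; Diamond–Shurman §5.10). [cite: BreuilConradDiamondTaylor2001] -/
def IsNewformOf.completedCuspFormL_eq_completedLFunction : Prop :=
  ∀ {W : WeierstrassCurve ℚ} [W.IsElliptic] {f : CuspForm (Gamma0 N) 2} (h : IsNewformOf W f) {s : ℂ} (hs : (2 : ℝ) < s.re),
    completedCuspFormL N f s = WeierstrassCurve.completedLFunction N W s

/- interim proof relied on results that are now named facts (D-0014); demoted to a fact by the D-0014 sorry-sweep, proof preserved:
:= by
  unfold completedCuspFormL WeierstrassCurve.completedLFunction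
  rw [h.entireLFunction_eq (by linarith)]
-/

/-- If `f` is the newform of `W` and `Λ` is the entire continuation of `Λ_N(f, s)`, then
`Λ(s) = N^{s/2} (2π)^{-s} Γ(s) L_entire(W, s)` (item G06's raw product
`WeierstrassCurve.completedLFunction N W`, built on the *entire* `W.entireLFunction`) at every
`s` off the poles of `Γ`, i.e. `s ∉ ℤ_{≤ 0}`. (At `s = -n` Mathlib's `Complex.Gamma` takes the
junk value `0`, so the raw product is *not* the continuation there; this is why membership of the
raw product in `completedCuspFormLContinuations N f` is not asserted.)
(Breuil–Conrad–Diamond–Taylor 2001; Diamond–Shurman Thm. 5.10.2.) [cite: BreuilConradDiamondTaylor2001] -/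
def IsNewformOf.completedLFunction_eq : Prop :=
  ∀ {W : WeierstrassCurve ℚ} [W.IsElliptic] {f : CuspForm (Gamma0 N) 2} (h : IsNewformOf W f) {Λ : ℂ → ℂ} (hΛ : Λ ∈ completedCuspFormLContinuations N f) {s : ℂ} (hs : ∀ n : ℕ, s ≠ -(n : ℂ)),
    Λ s = WeierstrassCurve.completedLFunction N W s

/-- If `f` is the newform of `W`, the analytic rank `ord_{s=1} L(W, s)` (item G06,
`WeierstrassCurve.analyticRank`) is the order of vanishing at `s = 1` of the entire continuation
`Λ` of `Λ_N(f, s)` (the factor `N^{s/2} (2π)^{-s} Γ(s)` is holomorphic and nonzero at `s = 1`)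
(Birch–Swinnerton-Dyer 1965; Diamond–Shurman §5.10). [cite: BirchSwinnertonDyer1965] -/
def IsNewformOf.analyticRank_eq_order : Prop :=
  ∀ {W : WeierstrassCurve ℚ} [W.IsElliptic] {f : CuspForm (Gamma0 N) 2} (h : IsNewformOf W f) {Λ : ℂ → ℂ} (hΛ : Λ ∈ completedCuspFormLContinuations N f),
    W.analyticRank = analyticOrderNatAt Λ 1

end Modularity

/-! ### The `q`-expansion principle and the two halves of `existsUnique_isNewformOf`

`existsUnique_isNewformOf` (`∃!`) splits as *existence* — the Modularity Theorem proper, in the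
form "Version `L`" of Diamond–Shurman Thm. 8.8.3 (`L(s, f) = L(s, E)` for some newform
`f ∈ S_2(Γ₀(N_E))`; Wiles 1995, Taylor–Wiles 1995, Breuil–Conrad–Diamond–Taylor 2001, Thm. A),
vendored as the named fact `exists_isNewformOf` — and *uniqueness*, which is elementary: a cusp
form on `Γ₀(N)` is determined by its Fourier coefficients (`eq_of_forall_cuspCoeff_eq`, from
Mathlib's `UpperHalfPlane.hasSum_qExpansion`), proved here as `IsNewformOf.unique`. The
equivalence is `existsUnique_isNewformOf_iff`. -/

section QExpansionPrinciple

variable {Γ : Subgroup (GL (Fin 2) ℝ)} {k : ℤ}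

/-- **`q`-expansion principle** at the cusp `∞`: a cusp form on a level `Γ` for which `1` is a
strict period (e.g. `Γ₀(N)`, `Γ₁(N)`) is determined by its Fourier coefficients `aₙ(f)`, since
`f(τ) = ∑ aₙ(f) qⁿ` on `ℍ` (Mathlib `UpperHalfPlane.hasSum_qExpansion`; Diamond–Shurman §1.1
and §5.8). [folklore] -/
theorem eq_of_forall_cuspCoeff_eq (hΓ : (1 : ℝ) ∈ Γ.strictPeriods) {f g : CuspForm Γ k}
    (h : ∀ n : ℕ, cuspCoeff f n = cuspCoeff g n) : f = g := by
  haveI : Fact (IsCusp OnePoint.infty Γ) := ⟨Γ.isCusp_of_mem_strictPeriods one_pos hΓ⟩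
  have hf := fun τ ↦ UpperHalfPlane.hasSum_qExpansion one_pos
    (SlashInvariantFormClass.periodic_comp_ofComplex f hΓ) (ModularFormClass.holo f)
    (ModularFormClass.bdd_at_infty f) τ
  have hg := fun τ ↦ UpperHalfPlane.hasSum_qExpansion one_pos
    (SlashInvariantFormClass.periodic_comp_ofComplex g hΓ) (ModularFormClass.holo g)
    (ModularFormClass.bdd_at_infty g) τ
  ext τ
  rw [← (hf τ).tsum_eq, ← (hg τ).tsum_eq]
  exact tsum_congr fun n ↦ by rw [show (qExpansion 1 ⇑f).coeff n = (qExpansion 1 ⇑g).coeff n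
    from h n]

/-- Two cusp forms on `Γ` (with `1` a strict period) are equal iff all their Fourier coefficients
agree (`q`-expansion principle). [folklore] -/
theorem eq_iff_forall_cuspCoeff_eq (hΓ : (1 : ℝ) ∈ Γ.strictPeriods) {f g : CuspForm Γ k} :
    f = g ↔ ∀ n : ℕ, cuspCoeff f n = cuspCoeff g n :=
  ⟨fun h _ ↦ h ▸ rfl, eq_of_forall_cuspCoeff_eq hΓ⟩

/-- On `Γ₀(N)` (where `1` is the strict width of `∞`, Mathlib `strictWidthInfty_Gamma0`): a cusp
form is determined by its Fourier coefficients (Diamond–Shurman §5.8). [folklore] -/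
theorem eq_of_forall_cuspCoeff_eq_gamma0 {N : ℕ} {f g : CuspForm (Gamma0 N) k}
    (h : ∀ n : ℕ, cuspCoeff f n = cuspCoeff g n) : f = g :=
  eq_of_forall_cuspCoeff_eq
    (strictWidthInfty_Gamma0 N ▸ Subgroup.strictWidthInfty_mem_strictPeriods _) h

end QExpansionPrinciple

section ModularityHalves

variable {N : ℕ} [NeZero N]

/-- **Uniqueness of the newform attached to `W`**, at any level: if `f, g ∈ S_2(Γ₀(N))` both
satisfy `IsNewformOf W ·` then `f = g`, since both have `q`-expansion `∑ aₙ(W) qⁿ`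
(`eq_of_forall_cuspCoeff_eq`). This is the elementary uniqueness half of
`existsUnique_isNewformOf`; it does not use that `f` is new or an eigenform. [folklore] -/
theorem IsNewformOf.unique {W : WeierstrassCurve ℚ} {f g : CuspForm (Gamma0 N) 2}
    (hf : IsNewformOf W f) (hg : IsNewformOf W g) : f = g :=
  eq_of_forall_cuspCoeff_eq_gamma0 fun n ↦ by rw [hf.2 n, hg.2 n]

/-- At most one cusp form in `S_2(Γ₀(N))` is the newform of `W`. [folklore] -/
theorem subsingleton_setOf_isNewformOf (W : WeierstrassCurve ℚ) :
    {f : CuspForm (Gamma0 N) 2 | IsNewformOf W f}.Subsingleton :=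
  fun _ hf _ hg ↦ hf.unique hg

/-- **Modularity Theorem, Version `L`** (the existence half of `existsUnique_isNewformOf`): for
every elliptic curve `E / ℚ` of conductor `N_E` there is a newform `f ∈ S_2(Γ₀(N_E))` with
`L(s, f) = L(s, E)`, i.e. `aₙ(f) = aₙ(E)` for all `n ≥ 1` — Diamond–Shurman 2005, Thm. 8.8.3
(§8.8; the Dirichlet coefficients `aₙ(E)` of
`L(s, E) = ∏_p (1 - a_p(E) p⁻ˢ + 𝟙_E(p) p^{1-2s})⁻¹` are those of their (8.44), here Mathlib's
`WeierstrassCurve.LFunction`, an Euler product of the same local factors of minimal models; equivalent to their Thm. 8.8.1,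
"Version `a_p`", by comparing the Euler products (8.43), (8.44)). Proved by Wiles 1995 and
Taylor–Wiles 1995 for semistable `E` and by Breuil–Conrad–Diamond–Taylor 2001, Thm. A, in
general ("if `E / ℚ` is an elliptic curve, then `E` is modular", where "modular" is any of the
equivalent conditions (1)–(6) of their §1, (2) being `L(E, s) = L(f, s)` for an eigenform `f` of
weight `2` and level `N(E)`; the reduction to level `N(E)` uses Carayol 1986). Together with
`IsNewformOf.unique` this is equivalent to `existsUnique_isNewformOf`
(`existsUnique_isNewformOf_iff`). [cite: DiamondShurman2005, Thm. 8.8.3] -/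
def exists_isNewformOf : Prop :=
  ∀ (W : WeierstrassCurve ℚ) [W.IsElliptic] [NeZero (W.conductorNorm ℤ)],
    ∃ f : CuspForm (Gamma0 (W.conductorNorm ℤ)) 2, IsNewformOf W f

/-- `∃! = ∃ +` uniqueness: the modularity statement `existsUnique_isNewformOf` is equivalent to
its existence half `exists_isNewformOf` (Diamond–Shurman Thm. 8.8.3), uniqueness of the newform
being the `q`-expansion principle (`IsNewformOf.unique`). [folklore] -/
theorem existsUnique_isNewformOf_iff : existsUnique_isNewformOf ↔ exists_isNewformOf := by
  refine ⟨fun h W _ _ ↦ (h W).exists, fun h W _ _ ↦ ?_⟩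
  obtain ⟨f, hf⟩ := h W
  exact ⟨f, hf, fun g hg ↦ hg.unique hf⟩

/-- The modularity theorem `existsUnique_isNewformOf` from its existence half
`exists_isNewformOf` (Diamond–Shurman Thm. 8.8.3; Breuil–Conrad–Diamond–Taylor 2001, Thm. A).
[cite: DiamondShurman2005, Thm. 8.8.3] -/
theorem existsUnique_isNewformOf_of_exists (h : exists_isNewformOf) :
    existsUnique_isNewformOf :=
  existsUnique_isNewformOf_iff.mpr h

/-- Conversely, `existsUnique_isNewformOf` yields its existence half. [folklore] -/
theorem exists_isNewformOf_of_existsUnique (h : existsUnique_isNewformOf) :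
    exists_isNewformOf :=
  existsUnique_isNewformOf_iff.mp h

end ModularityHalves

end Literature.NumberTheory.EllipticCurves.ModularForms
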